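import Mathlib.Topology.Homotopy.HomotopyGroup
import Literature.AlgebraicTopology.Homotopy.WeakHomotopyEquivalence
import HarnessLib

/-!
# Relative homotopy groups `πₙ(X, A, a)` and the maps of the homotopy sequence of a pair

Topic `Literature/AlgebraicTopology/Homotopy` (Hatcher, *Algebraic Topology* (2002), §4.1,
pp. 343–344; Miller, *Lectures on Algebraic Topology* (2020), Lecture 47, Def. 47.1). Mathlib
(pinned) has the absolute homotopy groups `HomotopyGroup N X x` as the quotient of the generalized
loops `Ω^ N X x` (maps `(Iᴺ, ∂Iᴺ) → (X, x)`) by homotopy rel `∂Iᴺ`, and nothing relative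
(`lean search 'RelGenLoop|relativeHomotopyGroup'` finds nothing). This file defines, all PROVED
(definitions with unfolding lemmas, no named facts):

* `RelGenLoop.jBoundary i` — for a coordinate `i : N`, the part
  `J = {y | y i = 1} ∪ {y | ∃ j ≠ i, y j ∈ {0, 1}}` of `∂Iᴺ` (Hatcher's `Jⁿ⁻¹`: the closure of
  `∂Iⁿ` minus the face `Iⁿ⁻¹`; here the free face is `{y | y i = 0}`, as in
  `GenLoopPath.jSet` of `GenLoopPaths.lean` where the free face of the cylinder is `t = 0`);
* `RelGenLoop i A a` — the **relative generalized loops**: maps `p : Iᴺ → X` with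
  `p {y i = 0} ⊆ A` and `p (J) = {a}`, i.e. maps of triples `(Iᴺ, ∂Iᴺ, J) → (X, A, a)`
  (Hatcher p. 343; Miller Def. 47.1), for a subspace `A : Set X` and a base point `a : A`;
* `RelGenLoop.Homotopic` — homotopy through such maps (Mathlib's `HomotopicWith`), an
  equivalence relation, and the **relative homotopy group**
  `RelHomotopyGroup i X A a := RelGenLoop i A a / Homotopic` — Hatcher's `πₙ(X, A, x₀)`,
  Miller's `πₙ(X, A, *) = [(Iⁿ, ∂Iⁿ, Jₙ), (X, A, *)]`, with `n = |N|`; `RelHomotopyGroup.Pi n X A a`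
  is the instance `N = Fin n`, `i = 0` (`n ≥ 1`);
* the three maps of the homotopy sequence of the pair (Hatcher p. 344, Thm. 4.3; Miller p. 155):
  `homotopyGroupIncl A a = i_* : π_N(A, a) → π_N(X, a)` (the existing `homotopyGroupMap` of the
  inclusion), `RelHomotopyGroup.ofAbsolute i = j_* : π_N(X, a) → π_N(X, A, a)` (a generalized
  loop is a relative one) and `RelHomotopyGroup.boundary = ∂ : π_N(X, A, a) → π_{N∖i}(A, a)`,
  restriction to the free face `{y i = 0} ≅ I^{N∖i}` (via Mathlib's `Cube.insertAt i`);
* functoriality `RelHomotopyGroup.map` in maps of pairs, and the two "complex" identities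
  `∂ ∘ j_* = 0`, `j_* ∘ i_* = 0` together with the easy half of the compression criterion
  (`RelGenLoop.homotopic_const_of_forall_mem`: a relative loop with image in `A` is trivial;
  Hatcher p. 343, "compression criterion", easy direction).

Exactness of the sequence (Hatcher Thm. 4.3; Miller Cor. 47.6) is proved in the sibling file
`RelativeHomotopySequence.lean`.

## Design notes

* As for Mathlib's `GenLoop`, the index type `N` is arbitrary and the special coordinate is a
  parameter `i : N` (compare `GenLoop.transAt i`, `GenLoop.loopHomeo i`, `Cube.splitAt i`): the
  relative group of a pair in "dimension `|N|`" is `RelHomotopyGroup i X A a` for any `i`; all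
  choices are in canonical bijection (permuting coordinates), which is not needed and not
  recorded here. The `Fin`-indexed abbreviation `RelHomotopyGroup.Pi n X A a` (`i = 0 : Fin n`,
  `[NeZero n]`) is `πₙ(X, A, a)`.
* Only the pointed-set structure is defined (base point `⟦RelGenLoop.const⟧`, the `default`);
  the group structure for `n ≥ 2` (abelian for `n ≥ 3`; Hatcher p. 343, Miller Cor. 47.6) is
  deliberately NOT constructed here — the long exact sequence is a sequence of pointed sets in
  its last terms anyway, and "`πₙ(X, A, a) = 0`" is `Subsingleton (RelHomotopyGroup i X A a)`.
* The base point is a point `a : A` of the subtype, so that `∂` lands in Mathlib's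
  `HomotopyGroup _ A a` and `i_*` is literally `homotopyGroupMap ⟨Subtype.val, _⟩ a` of
  `WeakHomotopyEquivalence.lean`, with target base point `(a : X)` definitionally.

## References

* A. Hatcher, *Algebraic Topology*, CUP (2002), §4.1, pp. 343–344 (relative homotopy groups,
  the long exact sequence Thm. 4.3, compression criterion). [HatcherAT2002]
* H. Miller, *Lectures on Algebraic Topology*, World Scientific (2020/2022), Lecture 47,
  Def. 47.1 and p. 155 (held copy PDF p. 155). [Miller2020]
-/

noncomputable section

open scoped Topology Topology.Homotopy unitInterval
open ContinuousMap

namespace Literature.AlgebraicTopology.Homotopy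

variable {N : Type*} {X Y : Type*} [TopologicalSpace X] [TopologicalSpace Y]

/-! ### The subset `J ⊆ ∂Iᴺ` -/

namespace RelGenLoop

/-- Hatcher's `Jⁿ⁻¹ ⊆ ∂Iⁿ` for the coordinate `i`: the points of the cube with `y i = 1` or with
some other coordinate equal to `0` or `1` (the closure of `∂Iᴺ` minus the free face `{y i = 0}`;
Hatcher 2002, p. 343; Miller 2020, p. 154, `Jₙ`). [cite: HatcherAT2002, §4.1 p. 343] -/
def jBoundary (i : N) : Set (I^N) := {y | y i = 1 ∨ ∃ j, j ≠ i ∧ (y j = 0 ∨ y j = 1)}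

/-- Membership in `jBoundary`. [folklore] -/
theorem mem_jBoundary {i : N} {y : I^N} :
    y ∈ jBoundary i ↔ y i = 1 ∨ ∃ j, j ≠ i ∧ (y j = 0 ∨ y j = 1) := Iff.rfl

/-- `J ⊆ ∂Iᴺ`. [folklore] -/
theorem jBoundary_subset_boundary (i : N) : jBoundary i ⊆ Cube.boundary N := by
  rintro y (hy | ⟨j, -, hj⟩)
  · exact ⟨i, Or.inr hy⟩
  · exact ⟨j, hj⟩

/-- `∂Iᴺ = {y i = 0} ∪ J`. [folklore] -/
theorem mem_boundary_iff (i : N) (y : I^N) : y ∈ Cube.boundary N ↔ y i = 0 ∨ y ∈ jBoundary i := by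
  constructor
  · rintro ⟨j, hj⟩
    by_cases hji : j = i
    · subst hji
      rcases hj with hj | hj
      · exact Or.inl hj
      · exact Or.inr (Or.inl hj)
    · exact Or.inr (Or.inr ⟨j, hji, hj⟩)
  · rintro (hy | hy)
    · exact ⟨i, Or.inl hy⟩
    · exact jBoundary_subset_boundary i hy

section insertAt

variable [DecidableEq N] (i : N)

/-- The `i`-th coordinate of `Cube.insertAt i (t, y')` is `t`. [folklore] -/
@[simp]
theorem insertAt_apply_self (t : I) (y' : I^{ j // j ≠ i }) : Cube.insertAt i (t, y') i = t := by
  rw [Homeomorph.funSplitAt_symm_apply, dif_pos rfl]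

/-- The other coordinates of `Cube.insertAt i (t, y')` are those of `y'`. [folklore] -/
@[simp]
theorem insertAt_apply_ne (t : I) (y' : I^{ j // j ≠ i }) (j : { j // j ≠ i }) :
    Cube.insertAt i (t, y') (j : N) = y' j := by
  rw [Homeomorph.funSplitAt_symm_apply, dif_neg j.2]

/-- `Cube.insertAt i (y i, y|) = y`. [folklore] -/
@[simp]
theorem insertAt_apply_restrict (y : I^N) : Cube.insertAt i (y i, fun j => y (j : N)) = y :=
  (Cube.splitAt i).symm_apply_apply y

/-- Inserting a boundary point of the small cube gives a point of `J` (a "wall"). [folklore] -/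
theorem insertAt_mem_jBoundary_of_mem_boundary (t : I) {y' : I^{ j // j ≠ i }}
    (hy' : y' ∈ Cube.boundary { j // j ≠ i }) : Cube.insertAt i (t, y') ∈ jBoundary i := by
  obtain ⟨j, hj⟩ := hy'
  exact Or.inr ⟨j, j.2, by rwa [insertAt_apply_ne]⟩

/-- Inserting at height `1` gives a point of `J`. [folklore] -/
theorem insertAt_one_mem_jBoundary (y' : I^{ j // j ≠ i }) : Cube.insertAt i (1, y') ∈ jBoundary i :=
  Or.inl (by simp)

/-- Inserting at height `0` or `1`, or a wall point, gives a boundary point of the big cube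
(Mathlib's `Cube.insertAt_boundary`, restated with `jBoundary`). [folklore] -/
theorem insertAt_mem_boundary_iff (t : I) (y' : I^{ j // j ≠ i }) :
    Cube.insertAt i (t, y') ∈ Cube.boundary N ↔ t = 0 ∨ t = 1 ∨ y' ∈ Cube.boundary { j // j ≠ i } := by
  constructor
  · rintro ⟨j, hj⟩
    by_cases hji : j = i
    · subst hji
      rw [insertAt_apply_self] at hj
      rcases hj with hj | hj
      · exact Or.inl hj
      · exact Or.inr (Or.inl hj)
    · rw [show j = ((⟨j, hji⟩ : { j // j ≠ i }) : N) from rfl, insertAt_apply_ne] at hj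
      exact Or.inr (Or.inr ⟨⟨j, hji⟩, hj⟩)
  · rintro (ht | ht | hy')
    · exact Cube.insertAt_boundary i (Or.inl (Or.inl ht))
    · exact Cube.insertAt_boundary i (Or.inl (Or.inr ht))
    · exact Cube.insertAt_boundary i (Or.inr hy')

end insertAt

end RelGenLoop

/-! ### Relative generalized loops -/

/-- **Relative generalized loops**: the maps of triples `(Iᴺ, ∂Iᴺ, J) → (X, A, a)`, i.e. continuous
`p : Iᴺ → X` sending the free face `{y | y i = 0}` into the subspace `A` and
`J = RelGenLoop.jBoundary i` (hence all the rest of `∂Iᴺ`) to the base point `a ∈ A`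
(Hatcher 2002, p. 343: "maps `(Iⁿ, ∂Iⁿ, Jⁿ⁻¹) → (X, A, x₀)`"; Miller 2020, Def. 47.1). The
relative analogue of Mathlib's `GenLoop`. [cite: HatcherAT2002, §4.1 p. 343] -/
def RelGenLoop (i : N) (A : Set X) (a : A) : Set C(I^N, X) :=
  {p | (∀ y : I^N, y i = 0 → p y ∈ A) ∧ ∀ y ∈ RelGenLoop.jBoundary i, p y = a}

namespace RelGenLoop

variable {i : N} {A : Set X} {a : A}

/-- Relative loops are functions `Iᴺ → X`. [folklore] -/
instance instFunLike : FunLike (RelGenLoop i A a) (I^N) X where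
  coe p := p.1
  coe_injective := fun ⟨⟨p, _⟩, _⟩ ⟨⟨q, _⟩, _⟩ _ => by congr

/-- Two relative loops with the same values are equal. [folklore] -/
@[ext]
theorem ext (p q : RelGenLoop i A a) (H : ∀ y, p y = q y) : p = q :=
  DFunLike.ext p q H

/-- The coercion of `⟨f, H⟩` is `f`. [folklore] -/
@[simp]
theorem mk_apply (f : C(I^N, X)) (H) (y : I^N) : (⟨f, H⟩ : RelGenLoop i A a) y = f y := rfl

/-- The underlying continuous map applied. [folklore] -/
@[simp]
theorem coe_apply (p : RelGenLoop i A a) (y : I^N) : (p : C(I^N, X)) y = p y := rfl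

/-- A relative loop sends the free face `{y i = 0}` into `A`. [folklore] -/
theorem apply_mem (p : RelGenLoop i A a) {y : I^N} (hy : y i = 0) : p y ∈ A := p.2.1 y hy

/-- A relative loop sends `J` to the base point. [folklore] -/
theorem apply_of_mem_jBoundary (p : RelGenLoop i A a) {y : I^N} (hy : y ∈ jBoundary i) : p y = a :=
  p.2.2 y hy

/-- A relative loop sends every boundary point into `A`. [folklore] -/
theorem apply_mem_of_mem_boundary (p : RelGenLoop i A a) {y : I^N} (hy : y ∈ Cube.boundary N) :
    p y ∈ A := by
  rcases (mem_boundary_iff i y).1 hy with hy | hy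
  · exact apply_mem p hy
  · rw [apply_of_mem_jBoundary p hy]; exact a.2

variable (i A a) in
/-- The constant relative loop at the base point (the base point of `πₙ(X, A, a)`). [folklore] -/
def const : RelGenLoop i A a :=
  ⟨ContinuousMap.const _ (a : X), fun _ _ => a.2, fun _ _ => rfl⟩

/-- The constant relative loop is constant. [folklore] -/
@[simp]
theorem const_apply (y : I^N) : (const i A a) y = a := rfl

/-- The constant relative loop inhabits `RelGenLoop i A a`. [folklore] -/
instance inhabited : Inhabited (RelGenLoop i A a) := ⟨const i A a⟩

variable (i) in
/-- A generalized loop at `a` in `X` is a relative loop of `(X, A, a)` (the map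
`j : (X, x₀, x₀) → (X, A, x₀)` of Hatcher p. 344). [cite: HatcherAT2002, §4.1 p. 344] -/
def ofGenLoop (p : Ω^ N X (a : X)) : RelGenLoop i A a :=
  ⟨p.1, fun y hy => by rw [p.2 y ⟨i, Or.inl hy⟩]; exact a.2,
    fun y hy => p.2 y (jBoundary_subset_boundary i hy)⟩

/-- `ofGenLoop` does not change the map. [folklore] -/
@[simp]
theorem ofGenLoop_apply (p : Ω^ N X (a : X)) (y : I^N) : ofGenLoop i p y = p y := rfl

/-- **Homotopy of relative loops**: homotopy through maps of triples `(Iᴺ, ∂Iᴺ, J) → (X, A, a)`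
(Hatcher 2002, p. 343: "homotopies through maps of the same form"); Mathlib's `HomotopicWith`
for the predicate `· ∈ RelGenLoop i A a`. [cite: HatcherAT2002, §4.1 p. 343] -/
def Homotopic (p q : RelGenLoop i A a) : Prop :=
  (p : C(I^N, X)).HomotopicWith (q : C(I^N, X)) (· ∈ RelGenLoop i A a)

namespace Homotopic

/-- Reflexivity. [folklore] -/
@[refl]
protected theorem refl (p : RelGenLoop i A a) : Homotopic p p := HomotopicWith.refl p.1 p.2

/-- Symmetry. [folklore] -/
@[symm]
protected theorem symm {p q : RelGenLoop i A a} (h : Homotopic p q) : Homotopic q p :=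
  HomotopicWith.symm h

/-- Transitivity. [folklore] -/
@[trans]
protected theorem trans {p q r : RelGenLoop i A a} (h : Homotopic p q) (h' : Homotopic q r) :
    Homotopic p r := HomotopicWith.trans h h'

/-- `Homotopic` is an equivalence relation. [folklore] -/
theorem equiv : Equivalence (@Homotopic N X _ i A a) :=
  ⟨Homotopic.refl, Homotopic.symm, Homotopic.trans⟩

end Homotopic

variable (i A a) in
/-- The setoid of relative loops up to homotopy. [folklore] -/
instance setoid : Setoid (RelGenLoop i A a) := ⟨Homotopic, Homotopic.equiv⟩

/-- Homotopic generalized loops are homotopic relative loops. [folklore] -/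
theorem homotopic_ofGenLoop {p q : Ω^ N X (a : X)} (h : GenLoop.Homotopic p q) :
    Homotopic (ofGenLoop i p : RelGenLoop i A a) (ofGenLoop i q) := by
  obtain ⟨H⟩ := h
  refine ⟨{ toHomotopy := H.toHomotopy, prop' := fun t => ⟨fun y hy => ?_, fun y hy => ?_⟩ }⟩
  · have h1 : H (t, y) = p y := H.prop' t y ⟨i, Or.inl hy⟩
    show H (t, y) ∈ A
    rw [h1]
    exact apply_mem (ofGenLoop i p : RelGenLoop i A a) hy
  · have h1 : H (t, y) = p y := H.prop' t y (jBoundary_subset_boundary i hy)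
    show H (t, y) = a
    rw [h1]
    exact p.2 y (jBoundary_subset_boundary i hy)

/-- **Compression, easy half**: a relative loop with image in `A` is homotopic, through relative
loops, to the constant loop — push the cube into the face `{y i = 1} ⊆ J` (Hatcher 2002,
p. 343, compression criterion, direction "⇐"). [cite: HatcherAT2002, §4.1 p. 343] -/
theorem homotopic_const_of_forall_mem [DecidableEq N] (p : RelGenLoop i A a) (hp : ∀ y, p y ∈ A) :
    Homotopic p (const i A a) := by
  -- `Φ (t, y)` raises the `i`-th coordinate of `y` to `min 1 (y i + t)`.
  let Φ : I × (I^N) → I^N := fun ty =>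
    Cube.insertAt i (Set.projIcc (0 : ℝ) 1 zero_le_one ((ty.2 i : ℝ) + ty.1), fun j => ty.2 (j : N))
  have hΦc : Continuous Φ := by
    refine (Cube.insertAt i).continuous.comp (Continuous.prodMk ?_ ?_)
    · exact continuous_projIcc.comp (by fun_prop)
    · exact continuous_pi fun j => (continuous_apply (j : N)).comp continuous_snd
  have hΦ0 : ∀ y : I^N, Φ (0, y) = y := fun y => by
    simp only [Φ, Set.Icc.coe_zero, add_zero, Set.projIcc_val zero_le_one]
    exact insertAt_apply_restrict i y
  have h1 : ∀ (t : I) (y : I^N), (1 : ℝ) ≤ (y i : ℝ) + t → Φ (t, y) ∈ jBoundary i := fun t y h => by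
    refine Or.inl ?_
    show Cube.insertAt i (_, _) i = 1
    rw [insertAt_apply_self, Set.projIcc_of_right_le zero_le_one h]
    rfl
  have hΦJ : ∀ (t : I) (y : I^N), y ∈ jBoundary i → Φ (t, y) ∈ jBoundary i := by
    rintro t y (hy | ⟨j, hji, hj⟩)
    · exact h1 t y (by rw [hy, Set.Icc.coe_one]; linarith [t.2.1])
    · refine Or.inr ⟨j, hji, ?_⟩
      show Cube.insertAt i (_, _) j = 0 ∨ Cube.insertAt i (_, _) j = 1
      rwa [show j = ((⟨j, hji⟩ : { j // j ≠ i }) : N) from rfl, insertAt_apply_ne]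
  have hΦ1 : ∀ y : I^N, Φ (1, y) ∈ jBoundary i := fun y =>
    h1 1 y (by rw [Set.Icc.coe_one]; linarith [(y i).2.1])
  exact ⟨{ toFun := fun ty => p (Φ ty)
           continuous_toFun := p.1.continuous.comp hΦc
           map_zero_left := fun y => by simp only [hΦ0]; rfl
           map_one_left := fun y => apply_of_mem_jBoundary p (hΦ1 y)
           prop' := fun t => ⟨fun y _ => hp _, fun y hy => apply_of_mem_jBoundary p (hΦJ t y hy)⟩ }⟩

/-- The relative loop `f ∘ p` of `(Y, B, f a)` induced by a map of pairs `f : (X, A) → (Y, B)`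
(Hatcher 2002, p. 344, induced maps on relative homotopy groups). [cite: HatcherAT2002, §4.1 p. 344] -/
def map {B : Set Y} (f : C(X, Y)) (hf : Set.MapsTo f A B) (p : RelGenLoop i A a) :
    RelGenLoop i B ⟨f a, hf a.2⟩ :=
  ⟨f.comp p.1, fun y hy => hf (apply_mem p hy), fun y hy => by
    show f (p y) = f a
    rw [apply_of_mem_jBoundary p hy]⟩

/-- `map f hf p` is `f ∘ p` pointwise. [folklore] -/
@[simp]
theorem map_apply {B : Set Y} (f : C(X, Y)) (hf : Set.MapsTo f A B) (p : RelGenLoop i A a) (y : I^N) :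
    map f hf p y = f (p y) := rfl

/-- Post-composition with a map of pairs preserves homotopy of relative loops. [folklore] -/
theorem homotopic_map {B : Set Y} (f : C(X, Y)) (hf : Set.MapsTo f A B) {p q : RelGenLoop i A a}
    (h : Homotopic p q) : Homotopic (map f hf p) (map f hf q) := by
  obtain ⟨H⟩ := h
  refine ⟨{ toFun := fun ty => f (H ty)
            continuous_toFun := f.continuous.comp H.continuous
            map_zero_left := fun y => by show f (H (0, y)) = f (p y); rw [H.apply_zero]; rfl
            map_one_left := fun y => by show f (H (1, y)) = f (q y); rw [H.apply_one]; rfl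
            prop' := fun t => ⟨fun y hy => hf ((H.prop' t).1 y hy), fun y hy => ?_⟩ }⟩
  show f (H (t, y)) = f a
  exact congrArg f ((H.prop' t).2 y hy)

section Face

variable [DecidableEq N]

/-- **Restriction to the free face** `{y i = 0} ≅ I^{N∖i}` (Hatcher's `Iⁿ⁻¹`), a generalized loop
in `A` at `a`: the map `∂` of Hatcher p. 344 at the level of loops (via Mathlib's
`Cube.insertAt i (0, ·)`). [cite: HatcherAT2002, §4.1 p. 344] -/
def face (p : RelGenLoop i A a) : Ω^ { j // j ≠ i } A a :=
  ⟨⟨fun y' => ⟨p (Cube.insertAt i (0, y')), apply_mem p (insertAt_apply_self i 0 y')⟩,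
      (p.1.continuous.comp ((Cube.insertAt i).continuous.comp
        (continuous_const.prodMk continuous_id))).subtype_mk _⟩,
    fun _ hy' => Subtype.ext
      (apply_of_mem_jBoundary p (insertAt_mem_jBoundary_of_mem_boundary i 0 hy'))⟩

/-- `face p y' = p (insertAt i (0, y'))` in `X`. [folklore] -/
@[simp]
theorem coe_face_apply (p : RelGenLoop i A a) (y' : I^{ j // j ≠ i }) :
    ((face p y' : A) : X) = p (Cube.insertAt i (0, y')) := rfl

/-- Homotopic relative loops have homotopic faces (rel `∂I^{N∖i}`), so `∂` descends to
`πₙ(X, A, a) → πₙ₋₁(A, a)`. [folklore] -/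
theorem homotopic_face {p q : RelGenLoop i A a} (h : Homotopic p q) :
    GenLoop.Homotopic (face p) (face q) := by
  obtain ⟨H⟩ := h
  have hc : Continuous fun ty' : I × (I^{ j // j ≠ i }) => H (ty'.1, Cube.insertAt i (0, ty'.2)) :=
    H.continuous.comp (continuous_fst.prodMk ((Cube.insertAt i).continuous.comp
      (continuous_const.prodMk continuous_snd)))
  refine ⟨{ toFun := fun ty' => ⟨H (ty'.1, Cube.insertAt i (0, ty'.2)),
              (H.prop' ty'.1).1 _ (insertAt_apply_self i 0 ty'.2)⟩
            continuous_toFun := hc.subtype_mk _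
            map_zero_left := fun y' => Subtype.ext (H.apply_zero _)
            map_one_left := fun y' => Subtype.ext (H.apply_one _)
            prop' := fun t y' hy' => Subtype.ext ?_ }⟩
  have hJ := insertAt_mem_jBoundary_of_mem_boundary i 0 hy'
  have h1 : H (t, Cube.insertAt i (0, y')) = a := (H.prop' t).2 _ hJ
  show H (t, Cube.insertAt i (0, y')) = p (Cube.insertAt i (0, y'))
  rw [h1, apply_of_mem_jBoundary p hJ]

end Face

end RelGenLoop

/-! ### Relative homotopy groups -/

/-- **The relative homotopy group** `πₙ(X, A, a)` (as a pointed set), `n = |N|`: relative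
generalized loops `(Iᴺ, ∂Iᴺ, J) → (X, A, a)` up to homotopy through such maps (Hatcher 2002,
p. 343; Miller 2020, Def. 47.1: "`πₙ(X, A, *) = [(Iⁿ, ∂Iⁿ, Jₙ), (X, A, *)]`"). The special
coordinate `i : N` singles out the free face `{y i = 0}`; the base point is `⟦RelGenLoop.const⟧`
(the `default` element). The group structure (`n ≥ 2`) is not constructed here.
[cite: HatcherAT2002, §4.1 p. 343] [cite: Miller2020, Def. 47.1] -/
def RelHomotopyGroup (i : N) (X : Type*) [TopologicalSpace X] (A : Set X) (a : A) : Type _ :=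
  Quotient (RelGenLoop.setoid i A a)

/-- **`πₙ(X, A, a)` with the standard indexing**: `N = Fin n`, free face `{y 0 = 0}` (`n ≥ 1`,
recorded as `[NeZero n]` so that `0 : Fin n` exists; compare Mathlib's `π_ n X x`).
[cite: HatcherAT2002, §4.1 p. 343] -/
abbrev RelHomotopyGroup.Pi (n : ℕ) [NeZero n] (X : Type*) [TopologicalSpace X] (A : Set X) (a : A) :
    Type _ :=
  RelHomotopyGroup (0 : Fin n) X A a

namespace RelHomotopyGroup

variable {i : N} {A : Set X} {a : A}

/-- The base point `⟦const⟧` of `πₙ(X, A, a)` is its `default` element. [folklore] -/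
instance inhabited : Inhabited (RelHomotopyGroup i X A a) := ⟨⟦RelGenLoop.const i A a⟧⟩

/-- The base point of `πₙ(X, A, a)` is the class of the constant loop. [folklore] -/
theorem default_def : (default : RelHomotopyGroup i X A a) = ⟦RelGenLoop.const i A a⟧ := rfl

/-- Two relative loops define the same element iff they are homotopic through relative loops.
[folklore] -/
theorem mk_eq_mk_iff (p q : RelGenLoop i A a) :
    (⟦p⟧ : RelHomotopyGroup i X A a) = ⟦q⟧ ↔ RelGenLoop.Homotopic p q := Quotient.eq

/-- A relative loop is trivial in `πₙ(X, A, a)` iff it is homotopic through relative loops to the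
constant loop. [folklore] -/
theorem mk_eq_default_iff (p : RelGenLoop i A a) :
    (⟦p⟧ : RelHomotopyGroup i X A a) = default ↔ RelGenLoop.Homotopic p (RelGenLoop.const i A a) :=
  Quotient.eq

variable (i) in
/-- **The map `j_* : πₙ(X, a) → πₙ(X, A, a)`** of the homotopy sequence of the pair, induced by
`(X, a, a) → (X, A, a)` (Hatcher 2002, p. 344; Miller 2020, p. 155: "the inclusion `{*} ↪ A`
induces a map `πₙ(X, *) → πₙ(X, A, *)`"). [cite: HatcherAT2002, §4.1 p. 344] -/
def ofAbsolute : HomotopyGroup N X (a : X) → RelHomotopyGroup i X A a :=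
  Quotient.map (RelGenLoop.ofGenLoop i) fun _ _ h => RelGenLoop.homotopic_ofGenLoop h

/-- `j_* [p] = [p]`. [folklore] -/
@[simp]
theorem ofAbsolute_mk (p : Ω^ N X (a : X)) :
    ofAbsolute i (⟦p⟧ : HomotopyGroup N X (a : X)) = (⟦RelGenLoop.ofGenLoop i p⟧ : RelHomotopyGroup i X A a) :=
  rfl

/-- `j_*` preserves base points. [folklore] -/
@[simp]
theorem ofAbsolute_const :
    ofAbsolute i (⟦GenLoop.const⟧ : HomotopyGroup N X (a : X)) = (default : RelHomotopyGroup i X A a) :=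
  congrArg (Quotient.mk _) (RelGenLoop.ext _ _ fun _ => rfl)

/-- **Induced map on relative homotopy groups** of a map of pairs `f : (X, A, a) → (Y, B, f a)`
(Hatcher 2002, p. 344). [cite: HatcherAT2002, §4.1 p. 344] -/
def map {B : Set Y} (f : C(X, Y)) (hf : Set.MapsTo f A B) :
    RelHomotopyGroup i X A a → RelHomotopyGroup i Y B ⟨f a, hf a.2⟩ :=
  Quotient.map (RelGenLoop.map f hf) fun _ _ h => RelGenLoop.homotopic_map f hf h

/-- `f_* [p] = [f ∘ p]`. [folklore] -/
@[simp]
theorem map_mk {B : Set Y} (f : C(X, Y)) (hf : Set.MapsTo f A B) (p : RelGenLoop i A a) :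
    map f hf (⟦p⟧ : RelHomotopyGroup i X A a) = ⟦RelGenLoop.map f hf p⟧ := rfl

/-- `f_*` preserves base points. [folklore] -/
@[simp]
theorem map_default {B : Set Y} (f : C(X, Y)) (hf : Set.MapsTo f A B) :
    map f hf (default : RelHomotopyGroup i X A a) = default :=
  congrArg (Quotient.mk _) (RelGenLoop.ext _ _ fun _ => rfl)

section Boundary

variable [DecidableEq N]

/-- **The boundary map `∂ : πₙ(X, A, a) → πₙ₋₁(A, a)`** of the homotopy sequence of the pair:
restriction to the free face `{y i = 0} ≅ I^{N∖i}` (Hatcher 2002, p. 344; Miller 2020, p. 155).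
[cite: HatcherAT2002, §4.1 p. 344] -/
def boundary : RelHomotopyGroup i X A a → HomotopyGroup { j // j ≠ i } A a :=
  Quotient.map RelGenLoop.face fun _ _ h => RelGenLoop.homotopic_face h

/-- `∂ [p] = [p | face]`. [folklore] -/
@[simp]
theorem boundary_mk (p : RelGenLoop i A a) :
    boundary (⟦p⟧ : RelHomotopyGroup i X A a) = (⟦RelGenLoop.face p⟧ : HomotopyGroup { j // j ≠ i } A a) :=
  rfl

/-- `∂` preserves base points. [folklore] -/
@[simp]
theorem boundary_default :
    boundary (default : RelHomotopyGroup i X A a) = (⟦GenLoop.const⟧ : HomotopyGroup { j // j ≠ i } A a) :=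
  congrArg (Quotient.mk _) (GenLoop.ext _ _ fun _ => rfl)

end Boundary

end RelHomotopyGroup

/-! ### The map `i_*` and the two complex identities of the homotopy sequence -/

/-- **The map `i_* : πₙ(A, a) → πₙ(X, a)`** induced by the inclusion of the subspace `A ⊆ X`
(Hatcher 2002, p. 344): `homotopyGroupMap` of `⟨Subtype.val, _⟩ : C(A, X)`, with target base
point `(a : X)`. [cite: HatcherAT2002, §4.1 p. 344] -/
abbrev homotopyGroupIncl (A : Set X) (a : A) : HomotopyGroup N A a → HomotopyGroup N X (a : X) :=
  homotopyGroupMap (⟨Subtype.val, continuous_subtype_val⟩ : C(A, X)) a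

variable {i : N} {A : Set X} {a : A}

/-- **`∂ ∘ j_*` is trivial** (Hatcher 2002, proof of Thm. 4.3: the restriction of a map
`(Iⁿ, ∂Iⁿ) → (X, x₀)` to the face `Iⁿ⁻¹` is constant). [cite: HatcherAT2002, Thm. 4.3] -/
theorem RelHomotopyGroup.boundary_ofAbsolute [DecidableEq N] (b : HomotopyGroup N X (a : X)) :
    RelHomotopyGroup.boundary (RelHomotopyGroup.ofAbsolute i b : RelHomotopyGroup i X A a) =
      ⟦GenLoop.const⟧ := by
  induction b using Quotient.inductionOn with
  | h p =>
    exact congrArg (Quotient.mk _) (GenLoop.ext _ _ fun y' =>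
      Subtype.ext (p.2 _ (Cube.insertAt_boundary i (Or.inl (Or.inl rfl)))))

/-- **`j_* ∘ i_*` is trivial** (Hatcher 2002, proof of Thm. 4.3, via the compression criterion:
a loop in `A` represents zero in `πₙ(X, A, a)`). [cite: HatcherAT2002, Thm. 4.3] -/
theorem RelHomotopyGroup.ofAbsolute_homotopyGroupIncl [DecidableEq N] (c : HomotopyGroup N A a) :
    (RelHomotopyGroup.ofAbsolute i (homotopyGroupIncl A a c) : RelHomotopyGroup i X A a) = default := by
  induction c using Quotient.inductionOn with
  | h q => exact Quotient.sound (RelGenLoop.homotopic_const_of_forall_mem _ fun y => (q y).2)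

/-- **`i_* ∘ ∂` is trivial** (Hatcher 2002, proof of Thm. 4.3): for a relative loop `p`, the map
`p` itself, read as `(t, y') ↦ p (insertAt i (t, y'))`, is a null-homotopy rel `∂I^{N∖i}` of
`p | face` in `X`. [cite: HatcherAT2002, Thm. 4.3] -/
theorem RelHomotopyGroup.homotopyGroupIncl_boundary [DecidableEq N] (c : RelHomotopyGroup i X A a) :
    homotopyGroupIncl A a (RelHomotopyGroup.boundary c) =
      (⟦GenLoop.const⟧ : HomotopyGroup { j // j ≠ i } X (a : X)) := by
  induction c using Quotient.inductionOn with
  | h p =>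
    refine Quotient.sound ⟨?_⟩
    exact
      { toFun := fun ty' => p (Cube.insertAt i ty')
        continuous_toFun := p.1.continuous.comp (Cube.insertAt i).continuous
        map_zero_left := fun y' => rfl
        map_one_left := fun y' =>
          RelGenLoop.apply_of_mem_jBoundary p (RelGenLoop.insertAt_one_mem_jBoundary i y')
        prop' := fun t y' hy' => by
          show p (Cube.insertAt i (t, y')) = p (Cube.insertAt i (0, y'))
          rw [RelGenLoop.apply_of_mem_jBoundary p
              (RelGenLoop.insertAt_mem_jBoundary_of_mem_boundary i t hy'),
            RelGenLoop.apply_of_mem_jBoundary p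
              (RelGenLoop.insertAt_mem_jBoundary_of_mem_boundary i 0 hy')] }

end Literature.AlgebraicTopology.Homotopy

end
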